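import Summits.SmoothPoincare4.SmoothPoincare4.Theses.ZeroSurgeryExotic
import Summits.SmoothPoincare4.SmoothPoincare4.Theorems.ZeroSurgeryExoticAssembly
import Literature.Topology.FourManifolds.HomotopyBallSliceProofs

/-!
# SmoothPoincare4 / ZeroSurgeryExotic — former route decl `Assembly3` (legacy glue, assembly v2 (a))

Item stmt-SmoothPoincare4-0521 of route ZeroSurgeryExotic was the route decl
`Summit.SmoothPoincare4.SmoothPoincare4.Theses.ZeroSurgeryExotic.Assembly3`,

  `Knot.exists_exotic_of_isHomotopyBallSlice_not_isSmoothlySlice →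
    (∃ K, K.IsHomotopyBallSlice ∧ ¬ K.IsSmoothlySlice) → ¬ SmoothPoincare4`,

i.e. granted the Freedman–Gompf–Morrison–Walker lemma (a knot slice in a homotopy 4-ball but not
in `B⁴` yields a closed smooth homotopy 4-sphere not diffeomorphic to `S⁴`), a knot that is slice
in a homotopy ball but not in `B⁴` refutes the smooth 4-dimensional Poincaré conjecture — pure logic,
four lines (the exotic `Σ ≃ₕ S⁴` is Hausdorff and second countable, so `SmoothPoincare4` hands us
`Nonempty (Σ ≃ₘ S⁴)`, contradicting `IsEmpty (Σ ≃ₘ S⁴)`), and `zeroSurgeryExotic_assembly3_proof`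
closed the item by restating against the route decl the earlier tree theorem
`Summit.SmoothPoincare4.ZeroSurgeryExotic.not_smoothPoincare4_of_isHomotopyBallSlice_not_isSmoothlySlice`
(`Theorems/ZeroSurgeryExoticAssembly.lean`, same statement, same proof).
[Freedman–Gompf–Morrison–Walker 2010, §1; Manolescu–Piccirillo 2023, §1]

Record (2026-08-17, dependency-drift repair). The multi-assembly lint of 2026-08-16T14:15Z dropped the
decls `Assembly2`, `Assembly3`, `Assembly4` from the gate-written route file (kept: `Assembly`; the item
stmt-0521 stays recorded as proved by `zeroSurgeryExotic_assembly3_proof`), so the theorem, stated against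
`…Theses.ZeroSurgeryExotic.Assembly3` by name, stopped elaborating ("Unknown identifier", full builds of
2026-08-16/17). Theorems files being append-only, the landed name is kept as a DEPRECATED ALIAS of the
identical surviving theorem `not_smoothPoincare4_of_isHomotopyBallSlice_not_isSmoothlySlice` (pattern of
`Theorems/SAWWeldingIdentificationAssembly2.lean`), and this file now records the one thing that changed in
substance since: the FGMW hypothesis is DISCHARGED in the tree
(`Literature.Topology.FourManifolds.Knot.exists_exotic_of_isHomotopyBallSlice_not_isSmoothlySlice_holds`,
`HomotopyBallSliceProofs.lean`), so the glue is now the unconditional implication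
`not_smoothPoincare4_of_exists_isHomotopyBallSlice_not_isSmoothlySlice`.
-/

namespace Summit.SmoothPoincare4.SmoothPoincare4.Theorems

open Summit.SmoothPoincare4.SmoothPoincare4.Theses.ZeroSurgeryExotic

/-- **A knot that is slice in a homotopy 4-ball but not in `B⁴` refutes the smooth 4-dimensional
Poincaré conjecture — unconditionally.** The former glue `Assembly3` with its first hypothesis, the
Freedman–Gompf–Morrison–Walker lemma, discharged by the tree theorem
`Knot.exists_exotic_of_isHomotopyBallSlice_not_isSmoothlySlice_holds` (FGMW 2010, §2 and Fact 2.1, via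
the Palais disc theorem): from the H-slice-not-slice knot obtain a closed smooth `M ≃ₕ S⁴` with
`IsEmpty (M ≃ₘ S⁴)`, and `SmoothPoincare4` applied to `M` yields `Nonempty (M ≃ₘ S⁴)`, contradiction.
[cite: FreedmanGompfMorrisonWalker2010, §2 p. 6 and Fact 2.1 (p. 7)] -/
theorem not_smoothPoincare4_of_exists_isHomotopyBallSlice_not_isSmoothlySlice :
    (∃ K : Literature.Topology.FourManifolds.Knot, K.IsHomotopyBallSlice ∧ ¬ K.IsSmoothlySlice) →
      ¬ SmoothPoincare4 :=
  Summit.SmoothPoincare4.ZeroSurgeryExotic.not_smoothPoincare4_of_isHomotopyBallSlice_not_isSmoothlySlice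
    Literature.Topology.FourManifolds.Knot.exists_exotic_of_isHomotopyBallSlice_not_isSmoothlySlice_holds

/-- Deprecated spelling: settled stmt-SmoothPoincare4-0521, the route decl `Assembly3` of route
ZeroSurgeryExotic (FGMW lemma → (∃ K, K slice in a homotopy 4-ball ∧ ¬ K slice in `B⁴`) →
¬ SmoothPoincare4), dropped from the route file by the multi-assembly lint of 2026-08-16; the identical
statement with the identical proof is the surviving tree theorem
`Summit.SmoothPoincare4.ZeroSurgeryExotic.not_smoothPoincare4_of_isHomotopyBallSlice_not_isSmoothlySlice`,
of which the old name is kept as a deprecated alias (Theorems files are append-only). [folklore] -/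
@[deprecated Summit.SmoothPoincare4.ZeroSurgeryExotic.not_smoothPoincare4_of_isHomotopyBallSlice_not_isSmoothlySlice
  (since := "2026-08-17")]
alias zeroSurgeryExotic_assembly3_proof :=
  Summit.SmoothPoincare4.ZeroSurgeryExotic.not_smoothPoincare4_of_isHomotopyBallSlice_not_isSmoothlySlice

end Summit.SmoothPoincare4.SmoothPoincare4.Theorems
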